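import Summits.QuantumAdvantage.QuantumAdvantage.Theorems.PerceptronDialLaws
import Literature.Computability.QuantumComplexity.QuadraticPolarForm

/-!
# PerceptronDialLaws — REV 3–5 additions (Theorems twin `PerceptronDialLaws.lean` e8f39841…, 1662 l; cell decomp-qadv, lens-3 g16 «PerceptronDial»;
supports stmt-QuantumAdvantage-27984 LiftA on AnfPresentation).  The rev-2 twin (7f51d403, 1053 l) is in the tree as `PerceptronDialLawsA/B/C/·`;
this delta carries, verbatim and in order, everything the refreshed twin ADDS after `end Core`:
* §10 `section VdC` — the van-der-Corput / Gauss LAW `gauss_vdc`, `gauss_vdc_quadP`, `isDegTwo_of_quadP`, `sum_signOf_additive`, `diff2` (F1);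
* §11 `section ThmA` — THEOREM A in kernel (F2): summing over the label first with the c_G-coordinate frozen (`cval_eq_ptv`, `bsum_eq`, explicit phases `gph`);
* §12 `section RankCount` — rank–nullity for the radical (F2c): the polar form is 𝔽₂-bilinear (`polL`), the polar matrix `polM`, `polM_eq_toMatrix`, radical = kernel count.
No `sorry`; standard axioms; no instances, no notation, no unsafe options.
-/

set_option linter.dupNamespace false

noncomputable section

namespace Summit.QuantumAdvantage.QuantumAdvantage.Theorems.PerceptronDial

open Finset
open Literature.Computability.Complexity
open Literature.Computability.QuantumComplexity
open Literature.Computability.QuantumComplexity.BuzetChailloux (bxor zeroVec)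
open Summit.QuantumAdvantage.QuantumAdvantage.Theses.AnfPresentation
  (AnfResidual RungA LiftA NearExactIsExact SignedExactSliceIsLift AnfEquiv)
open Summit.QuantumAdvantage.QuantumAdvantage.Theorems.HintDial
  (IsDualOf forrelation_eq_one_of_isDualOf flipConst value_flipConst rungA_of_anfResidual)
open Summit.QuantumAdvantage.QuantumAdvantage.Theorems.HintDial.Automaton
  (bd sgl mv MM blTable eval_blTable bd_sgl_left bd_bxor_right dualFn dualFn_append isDualOf_blTable
    bit_bd bit_decide_and signOf_bd mv_bxor mv_eq_iff bxor_left_eq_iff' bd_zeroVec_right)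
open Summit.QuantumAdvantage.QuantumAdvantage.Theorems.HintDial (bit_xor bit_and bit_not bit_eq_ite bit_decide_odd bit_injective bit_mul_self bit_false eval_bit)
open CubicForm (bit)
open DerivativeWalsh (W)
open Summit.QuantumAdvantage.QuantumAdvantage.Theorems.PebbleDial (AnfIdx bitsFG bits)

variable {n k : ℕ}

/-! ## §10  LAW (F1 of NODE-g16.md §4.8(F), kernel): the van-der-Corput / Gauss bound

For a Boolean function `Q : {0,1}ⁿ → {0,1}` of algebraic degree `≤ 2` (every second difference additive —
in particular every `QuadP`-polynomial, `isDegTwo_of_quadP`),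
`(Σ_x (−1)^{Q(x)})² ≤ 2ⁿ · |rad2 Q|` where `rad2 Q` is the radical of the polar form (`gauss_vdc`,
`gauss_vdc_quadP`).  With `|rad2 Q| = 2^{n − rank}` this is `|E_x (−1)^{Q(x)}| ≤ 2^{−rank/2}`, the Gauss-sum
estimate that THEOREM A and the MATRIX LEMMA of the paper proof of `CoreBias` (NODE-g16.md §4.8) consume;
it is the first formalisation step F1 of §4.8(F).  Proof: expand the square, reindex `y = x ⊕ h`, and use that the
character sum of an additive Boolean function is `2ⁿ·[≡ 0]` (`sum_signOf_additive`, by the sign-flipping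
involution `x ↦ x ⊕ x₀`). -/

section VdC

open Literature.Computability.QuantumComplexity.BuzetChailloux (bxorPerm bxorPerm_apply)

variable {n : ℕ}

/-- the SECOND DIFFERENCE `Q(x ⊕ h) ⊕ Q(x) ⊕ Q(h) ⊕ Q(0)` (the diff2 form of `Q` at `(x,h)` when `deg Q ≤ 2`) -/
def diff2 (Q : (Fin n → Bool) → Bool) (h x : Fin n → Bool) : Bool :=
  xor (xor (Q (bxor x h)) (Q x)) (xor (Q h) (Q zeroVec))

/-- «`Q` has algebraic degree `≤ 2`»: every second difference is additive. -/
def IsDegTwo (Q : (Fin n → Bool) → Bool) : Prop :=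
  ∀ h x y, diff2 Q h (bxor x y) = xor (diff2 Q h x) (diff2 Q h y)

/-- the RADICAL of the diff2 form: the directions `h` with `Q(x ⊕ h) ⊕ Q(x)` constant in `x` -/
def rad2 (Q : (Fin n → Bool) → Bool) : Finset (Fin n → Bool) :=
  univ.filter fun h => ∀ x, diff2 Q h x = false

/-- character sum of an ADDITIVE Boolean function: `2ⁿ` if it vanishes identically, else `0`
(the involution `x ↦ x ⊕ x₀` with `φ x₀ = 1` flips every sign). -/
theorem sum_signOf_additive (φ : (Fin n → Bool) → Bool)
    (hφ : ∀ x y, φ (bxor x y) = xor (φ x) (φ y)) :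
    ∑ x, signOf (φ x) = if (∀ x, φ x = false) then (2 : ℝ) ^ n else 0 := by
  split_ifs with h
  · simp_rw [h]; simp [signOf]
  · obtain ⟨x₀, hx₀⟩ : ∃ x₀, φ x₀ ≠ false := by simpa using h
    have hx₀' : φ x₀ = true := by simpa using hx₀
    have hs : signOf true = -1 := by norm_num [signOf]
    have key : ∑ x, signOf (φ x) = - ∑ x, signOf (φ x) := by
      calc ∑ x, signOf (φ x) = ∑ x, signOf (φ (bxorPerm x₀ x)) :=
            (Equiv.sum_comp (bxorPerm x₀) (fun x => signOf (φ x))).symm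
        _ = ∑ x, - signOf (φ x) := sum_congr rfl fun x _ => by
            rw [bxorPerm_apply, hφ, hx₀', signOf_xor, hs]; ring
        _ = - ∑ x, signOf (φ x) := sum_neg_distrib _
    linarith

/-- the Boolean bookkeeping identity `Q x ⊕ Q (x ⊕ h) = (Q h ⊕ Q 0) ⊕ diff2 Q h x` -/
theorem xor_eq_diff2 (Q : (Fin n → Bool) → Bool) (h x : Fin n → Bool) :
    xor (Q x) (Q (bxor x h)) = xor (xor (Q h) (Q zeroVec)) (diff2 Q h x) := by
  simp only [diff2]
  generalize Q x = a; generalize Q (bxor x h) = b; generalize Q h = c; generalize Q zeroVec = d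
  cases a <;> cases b <;> cases c <;> cases d <;> rfl

/-- ★ LAW (F1, van der Corput / Gauss bound). For `Q : {0,1}ⁿ → {0,1}` of algebraic degree `≤ 2`,
`(Σ_x (−1)^{Q(x)})² ≤ 2ⁿ · |rad2 Q|`; with `|rad2 Q| = 2^{n − rank}` this is the Gauss-sum bound
`|E (−1)^Q| ≤ 2^{−rank/2}` used in THEOREM A / the MATRIX LEMMA of NODE-g16.md §4.8. -/
theorem gauss_vdc (Q : (Fin n → Bool) → Bool) (hQ : IsDegTwo Q) :
    (∑ x, signOf (Q x)) ^ 2 ≤ (2 : ℝ) ^ n * (rad2 Q).card := by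
  have step : (∑ x, signOf (Q x)) ^ 2
      = ∑ h, signOf (xor (Q h) (Q zeroVec)) * ∑ x, signOf (diff2 Q h x) := by
    rw [sq, sum_mul_sum]
    calc ∑ x, ∑ y, signOf (Q x) * signOf (Q y)
        = ∑ x, ∑ h, signOf (Q x) * signOf (Q (bxor x h)) := sum_congr rfl fun x _ =>
            (Equiv.sum_comp (bxorPerm x) (fun y => signOf (Q x) * signOf (Q y))).symm
      _ = ∑ h, ∑ x, signOf (Q x) * signOf (Q (bxor x h)) := sum_comm
      _ = ∑ h, signOf (xor (Q h) (Q zeroVec)) * ∑ x, signOf (diff2 Q h x) :=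
            sum_congr rfl fun h _ => by
              rw [mul_sum]
              exact sum_congr rfl fun x _ => by rw [← signOf_xor, ← signOf_xor, xor_eq_diff2]
  rw [step]
  calc ∑ h, signOf (xor (Q h) (Q zeroVec)) * ∑ x, signOf (diff2 Q h x)
      = ∑ h, signOf (xor (Q h) (Q zeroVec)) * (if (∀ x, diff2 Q h x = false) then (2 : ℝ) ^ n else 0) :=
          sum_congr rfl fun h _ => by rw [sum_signOf_additive _ (hQ h)]
    _ = ∑ h ∈ rad2 Q, signOf (xor (Q h) (Q zeroVec)) * (2 : ℝ) ^ n := by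
          rw [rad2, sum_filter]
          exact sum_congr rfl fun h _ => by split_ifs <;> simp
    _ ≤ ∑ h ∈ rad2 Q, (2 : ℝ) ^ n := sum_le_sum fun h _ => by
          have h1 : signOf (xor (Q h) (Q zeroVec)) ≤ 1 := by
            cases (xor (Q h) (Q zeroVec)) <;> norm_num [signOf]
          have h2 : (0 : ℝ) ≤ (2 : ℝ) ^ n := by positivity
          nlinarith
    _ = (2 : ℝ) ^ n * (rad2 Q).card := by rw [sum_const, nsmul_eq_mul, mul_comm]

/-! ### every quadratic polynomial has degree ≤ 2 (the bridge to `QuadP` of §9) -/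

/-- the (symmetrised) bilinear form of `P` -/
def QuadP.pol (P : QuadP (Fin n)) (x h : Fin n → Bool) : ZMod 2 :=
  ∑ i, ∑ j, P.q i j * (bit (x i) * bit (h j) + bit (h i) * bit (x j))

/-- PerceptronDialLawsEA helper `QuadP.ev_diff2` (decomp-qadv land package; see the module docstring). -/
theorem QuadP.ev_diff2 (P : QuadP (Fin n)) (x h : Fin n → Bool) :
    P.ev (bxor x h) + P.ev x + (P.ev h + P.ev zeroVec) = P.pol x h := by
  have two : (2 : ZMod 2) = 0 := by decide
  have e : P.ev (bxor x h) + P.ev x + (P.ev h + P.ev zeroVec)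
      = (P.c + P.c + P.c + P.c)
        + ∑ i, (P.l i * (bit (x i) + bit (h i)) + P.l i * bit (x i) + P.l i * bit (h i) + P.l i * bit false)
        + ∑ i, ∑ j, (P.q i j * ((bit (x i) + bit (h i)) * (bit (x j) + bit (h j)))
            + P.q i j * (bit (x i) * bit (x j)) + P.q i j * (bit (h i) * bit (h j))
            + P.q i j * (bit false * bit false)) := by
    simp only [QuadP.ev, sum_add_distrib, bxor, bit_xor, zeroVec]
    ring
  have hc : P.c + P.c + P.c + P.c = 0 := by linear_combination (2 * P.c) * two
  have hl : ∀ i, P.l i * (bit (x i) + bit (h i)) + P.l i * bit (x i) + P.l i * bit (h i) + P.l i * bit false = 0 := by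
    intro i; simp only [bit_false, mul_zero, add_zero]
    linear_combination (P.l i * bit (x i) + P.l i * bit (h i)) * two
  have hq : ∀ i j, P.q i j * ((bit (x i) + bit (h i)) * (bit (x j) + bit (h j)))
            + P.q i j * (bit (x i) * bit (x j)) + P.q i j * (bit (h i) * bit (h j))
            + P.q i j * (bit false * bit false)
      = P.q i j * (bit (x i) * bit (h j) + bit (h i) * bit (x j)) := by
    intro i j; simp only [bit_false, mul_zero, add_zero]
    linear_combination (P.q i j * (bit (x i) * bit (x j)) + P.q i j * (bit (h i) * bit (h j))) * two
  rw [e, hc, zero_add]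
  simp only [hl, sum_const_zero, zero_add, hq, QuadP.pol]

/-- PerceptronDialLawsEA helper `QuadP.pol_bxor_left` (decomp-qadv land package; see the module docstring). -/
theorem QuadP.pol_bxor_left (P : QuadP (Fin n)) (x y h : Fin n → Bool) :
    P.pol (bxor x y) h = P.pol x h + P.pol y h := by
  simp only [QuadP.pol, bxor, bit_xor, ← sum_add_distrib]
  exact sum_congr rfl fun i _ => sum_congr rfl fun j _ => by ring

/-- ★ a Boolean function that IS a quadratic polynomial has degree `≤ 2`; so `gauss_vdc` applies to it. -/
theorem isDegTwo_of_quadP (Q : (Fin n → Bool) → Bool) (P : QuadP (Fin n))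
    (hP : ∀ x, bit (Q x) = P.ev x) : IsDegTwo Q := by
  have hb : ∀ h z, bit (diff2 Q h z) = P.pol z h := by
    intro h z; simp only [diff2, bit_xor, hP]; exact P.ev_diff2 z h
  intro h x y
  apply bit_injective
  rw [hb, bit_xor, hb, hb, QuadP.pol_bxor_left]

/-- ★ COROLLARY (the form used in §4.8): `(Σ_x (−1)^{P(x)})² ≤ 2ⁿ·|rad2 Q|` for every quadratic polynomial `P`. -/
theorem gauss_vdc_quadP (Q : (Fin n → Bool) → Bool) (P : QuadP (Fin n)) (hP : ∀ x, bit (Q x) = P.ev x) :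
    (∑ x, signOf (Q x)) ^ 2 ≤ (2 : ℝ) ^ n * (rad2 Q).card :=
  gauss_vdc Q (isDegTwo_of_quadP Q P hP)

end VdC

/-! ## §11  THEOREM A in kernel (F2 of NODE-g16.md §4.8(F)): `CoreBias` reduced to a radical bound for EXPLICIT degree-2 phases

Summing over the label `b` first and applying §10: for a quadratic polynomial `P` in the visible variables, the correlation sum
of `CoreBias` satisfies `|Σ_w (−1)^b (−1)^{P(cval w)}| ≤ Σ_B Σ_{c ∈ 𝔽₂} |Σ_{(s,t)} (−1)^{G_{P,B,c}(s,t)}|` where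
`G_{P,B,c}(s,t) := ⟨t,s⟩ ⊕ Q_B(s) ⊕ P(s, t, [a<a']B, polar_B s, c)` (`gph`) — the visible point with the ONE label-carrying coordinate
`c_G` frozen to the constant `c` — is a Boolean function of `(s,t) ∈ 𝔽₂^{2m}` of algebraic degree `≤ 2` (`isDegTwo_gph`: a quadratic
polynomial evaluated at coordinates affine in `(s,t)`, plus the quadratic `⟨t,s⟩ ⊕ Q_B(s)`), so `gauss_vdc` bounds each inner sum by
`√(2^{2m}·|rad2 G_{P,B,c}|)` (`abs_corr_le_radSum`).  Hence ★ `coreBias_of_radBound : RadBound → CoreBias`, where `RadBound` asks, for every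
polynomial `p` at some scale `m`, `2·p(2m)·Σ_B Σ_c √(2^{2m}|rad2 G_{P,B,c}|) < |QParam m|` — i.e. (with `|rad2 G| = 2^{2m−rank M_P(B)}`)
`E_B 2^{−rank M_P(B)/2} < 1/(2p(2m))`, exactly the MATRIX LEMMA's hypothesis shape (NODE-g16.md §4.8).  The degree calculus is done over
`ZMod 2` (`IsAffZ`, `IsDegTwoZ`: closed under sums, scalars, products of two affine functions, and composition of a `QuadP` with affine
coordinates — `isDegTwoZ_ev`). -/

section ThmA

variable {n : ℕ}

/-! ### 11.1 a linear «degree ≤ 2» calculus over `ZMod 2` -/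

/-- second difference of a `ZMod 2`-valued function on `𝔽₂ⁿ` -/
def dZ (φ : (Fin n → Bool) → ZMod 2) (h x : Fin n → Bool) : ZMod 2 := φ (bxor x h) + φ x + (φ h + φ zeroVec)

/-- `ZMod 2`-valued «algebraic degree ≤ 2»: additive second differences -/
def IsDegTwoZ (φ : (Fin n → Bool) → ZMod 2) : Prop := ∀ h x y, dZ φ h (bxor x y) = dZ φ h x + dZ φ h y

/-- `ZMod 2`-valued «affine» -/
def IsAffZ (α : (Fin n → Bool) → ZMod 2) : Prop := ∀ x y, α (bxor x y) = α x + α y + α zeroVec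

/-- PerceptronDialLawsEA helper `isDegTwo_of_Z` (decomp-qadv land package; see the module docstring). -/
theorem isDegTwo_of_Z (Q : (Fin n → Bool) → Bool) (hQ : IsDegTwoZ (fun x => bit (Q x))) : IsDegTwo Q := by
  intro u x y
  apply bit_injective
  have e : ∀ z, bit (diff2 Q u z) = dZ (fun x => bit (Q x)) u z := fun z => by simp only [diff2, dZ, bit_xor]
  rw [e, bit_xor, e, e]
  exact hQ u x y

/-- PerceptronDialLawsEA helper `isDegTwoZ_congr` (decomp-qadv land package; see the module docstring). -/
theorem isDegTwoZ_congr {φ ψ : (Fin n → Bool) → ZMod 2} (h : ∀ x, φ x = ψ x) (hψ : IsDegTwoZ ψ) : IsDegTwoZ φ := by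
  have e : φ = ψ := funext h
  rw [e]; exact hψ

/-- PerceptronDialLawsEA helper `isDegTwoZ_const` (decomp-qadv land package; see the module docstring). -/
theorem isDegTwoZ_const (c : ZMod 2) : IsDegTwoZ (fun _ : Fin n → Bool => c) := by
  intro h x y
  simp only [dZ]
  linear_combination (-(2 * c)) * Literature.Computability.QuantumComplexity.QuadPolar.two_eq_zero

/-- PerceptronDialLawsEA helper `isDegTwoZ_add` (decomp-qadv land package; see the module docstring). -/
theorem isDegTwoZ_add {φ ψ : (Fin n → Bool) → ZMod 2} (hφ : IsDegTwoZ φ) (hψ : IsDegTwoZ ψ) :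
    IsDegTwoZ (fun x => φ x + ψ x) := by
  intro h x y
  have e : ∀ z, dZ (fun x => φ x + ψ x) h z = dZ φ h z + dZ ψ h z := fun z => by simp only [dZ]; ring
  rw [e, e, e, hφ, hψ]; ring

/-- PerceptronDialLawsEA helper `isDegTwoZ_mul_const` (decomp-qadv land package; see the module docstring). -/
theorem isDegTwoZ_mul_const (c : ZMod 2) {φ : (Fin n → Bool) → ZMod 2} (hφ : IsDegTwoZ φ) :
    IsDegTwoZ (fun x => c * φ x) := by
  intro h x y
  have e : ∀ z, dZ (fun x => c * φ x) h z = c * dZ φ h z := fun z => by simp only [dZ]; ring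
  rw [e, e, e, hφ]; ring

/-- PerceptronDialLawsEA helper `isDegTwoZ_sum` (decomp-qadv land package; see the module docstring). -/
theorem isDegTwoZ_sum {κ : Type} [DecidableEq κ] (s : Finset κ) (g : κ → (Fin n → Bool) → ZMod 2)
    (hg : ∀ k ∈ s, IsDegTwoZ (g k)) : IsDegTwoZ (fun x => ∑ k ∈ s, g k x) := by
  induction s using Finset.induction_on with
  | empty =>
      exact isDegTwoZ_congr (ψ := fun _ => 0) (fun x => sum_empty) (isDegTwoZ_const 0)
  | insert a s ha ih =>
      exact isDegTwoZ_congr (ψ := fun x => g a x + ∑ k ∈ s, g k x) (fun x => sum_insert ha)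
        (isDegTwoZ_add (hg a (mem_insert_self a s)) (ih fun k hk => hg k (mem_insert_of_mem hk)))

/-- PerceptronDialLawsEA helper `isDegTwoZ_of_isAffZ` (decomp-qadv land package; see the module docstring). -/
theorem isDegTwoZ_of_isAffZ {α : (Fin n → Bool) → ZMod 2} (hα : IsAffZ α) : IsDegTwoZ α := by
  have e : ∀ h z, dZ α h z = 0 := fun h z => by
    simp only [dZ]
    rw [hα]
    linear_combination (α z + α h + α zeroVec) * Literature.Computability.QuantumComplexity.QuadPolar.two_eq_zero
  intro h x y
  rw [e, e, e, add_zero]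

/-- the product of two affine functions has degree `≤ 2` (an identity that holds exactly modulo 2) -/
theorem isDegTwoZ_mul {α β : (Fin n → Bool) → ZMod 2} (hα : IsAffZ α) (hβ : IsAffZ β) :
    IsDegTwoZ (fun x => α x * β x) := by
  intro h x y
  simp only [dZ]
  rw [hα (bxor x y) h, hβ (bxor x y) h, hα x y, hβ x y, hα x h, hβ x h, hα y h, hβ y h]
  generalize α x = a₁; generalize α y = a₂; generalize α h = a₃; generalize α zeroVec = a₄
  generalize β x = b₁; generalize β y = b₂; generalize β h = b₃; generalize β zeroVec = b₄
  revert a₁ a₂ a₃ a₄ b₁ b₂ b₃ b₄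
  decide

/-- PerceptronDialLawsEA helper `isAffZ_coord` (decomp-qadv land package; see the module docstring). -/
theorem isAffZ_coord (u : Fin n) : IsAffZ (fun x : Fin n → Bool => bit (x u)) := by
  intro x y
  show bit (xor (x u) (y u)) = bit (x u) + bit (y u) + bit false
  rw [bit_xor, bit_false, add_zero]

/-- PerceptronDialLawsEA helper `isAffZ_const` (decomp-qadv land package; see the module docstring). -/
theorem isAffZ_const (c : ZMod 2) : IsAffZ (fun _ : Fin n → Bool => c) := by
  intro x y
  linear_combination (-c) * Literature.Computability.QuantumComplexity.QuadPolar.two_eq_zero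

/-- ★ composition: a quadratic polynomial evaluated at coordinates affine in `x` has degree `≤ 2` in `x` -/
theorem isDegTwoZ_ev {ι : Type} [Fintype ι] (P : QuadP ι) (A : (Fin n → Bool) → ι → Bool)
    (hA : ∀ i, IsAffZ (fun x => bit (A x i))) : IsDegTwoZ (fun x => P.ev (A x)) := by
  classical
  have h1 : IsDegTwoZ (fun x => ∑ i, P.l i * bit (A x i)) :=
    isDegTwoZ_sum _ (fun i x => P.l i * bit (A x i)) fun i _ => isDegTwoZ_mul_const _ (isDegTwoZ_of_isAffZ (hA i))
  have h2 : IsDegTwoZ (fun x => ∑ i, ∑ j, P.q i j * (bit (A x i) * bit (A x j))) :=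
    isDegTwoZ_sum _ (fun i x => ∑ j, P.q i j * (bit (A x i) * bit (A x j))) fun i _ =>
      isDegTwoZ_sum _ (fun j x => P.q i j * (bit (A x i) * bit (A x j))) fun j _ =>
        isDegTwoZ_mul_const _ (isDegTwoZ_mul (hA i) (hA j))
  exact isDegTwoZ_add (isDegTwoZ_add (isDegTwoZ_const P.c) h1) h2

/-! ### 11.2 the explicit degree-2 phases `G_{P,B,c}` of THEOREM A -/

variable {m : ℕ}

/-- the `s`-half of `x = (s,t) ∈ 𝔽₂^{m+m}` -/
def sOf (x : Fin (m + m) → Bool) : Fin m → Bool := fun a => x (Fin.castAdd m a)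
/-- the `t`-half of `x = (s,t) ∈ 𝔽₂^{m+m}` -/
def tOf (x : Fin (m + m) → Bool) : Fin m → Bool := fun a => x (Fin.natAdd m a)

/-- the label-free part `⟨t,s⟩ ⊕ Q_B(s)` of `c_G` -/
def c0 (B : Fin m → Fin m → Bool) (x : Fin (m + m) → Bool) : Bool := xor (bd (tOf x) (sOf x)) (qf B (sOf x))

open CVar in
/-- the visible point of `(s,t,B)` with the `c_G`-coordinate FROZEN to the constant `c` -/
def ptv (B : Fin m → Fin m → Bool) (c : Bool) (x : Fin (m + m) → Bool) : CVar m → Bool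
  | Sum.inl a => sOf x a
  | Sum.inr (Sum.inl a) => tOf x a
  | Sum.inr (Sum.inr (Sum.inl aa)) => ut B aa.1 aa.2
  | Sum.inr (Sum.inr (Sum.inr (Sum.inl a))) => polar B (sOf x) a
  | Sum.inr (Sum.inr (Sum.inr (Sum.inr _))) => c


end ThmA
end Summit.QuantumAdvantage.QuantumAdvantage.Theorems.PerceptronDial
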